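import Literature.IUT.HodgeTheaters.ThetaPMEllHodgeTheatersF
import Literature.IUT.HodgeTheaters.ThetaNFKit

/-!
# [IUTchI] §6, Remark 6.12.2 (ii): isomorphisms of Θ^{±ell}NF-Hodge theaters and of their 𝒟-versions

Mochizuki, *Inter-universal Teichmüller theory I*, §6, Remark 6.12.2 (ii) pp. 174–175 ("by applying
Propositions 4.8, 6.6, and Corollaries 5.6, 6.12, one may verify analogues of these results for such
Θ^{±ell}NF-Hodge theaters … We leave the routine details to the reader") and Definition 6.13 (i), (ii)
pp. 182–183, kurims manuscript (May 2020) ([IUTchI] Rmk 6.12.2 (ii) p.174) [claim: Mochizuki2012, status: disputed].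
Sibling of `ThetaPMEllHodgeTheaters.lean` (abc-iut-L5-t4: `S5Local.ThetaGluing`, `ThetaPMEllNFHT`,
`DThetaPMEllNFHT`) typing the ISOMORPHISM notions [IUTchII] §4 and [IUTchIII] Def 1.1, 3.8 consume
("the full poly-isomorphism between Θ^{±ell}NF-Hodge theaters"; L5-lead ruling 2026-08-25 F2):

* the ΘNF-side isomorphism notions, which the kit `S5Local` does not carry, enter through the small
  hypothesis kit `S5Local.IsoKit` (every field `TODO-merge:abc-iut-L5-t3`: the associated 𝒟-ΘNF-Hodge
  theater of a ΘNF-Hodge theater, the types of isomorphisms of ΘNF- / 𝒟-ΘNF-Hodge theaters and the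
  bijections of index sets they induce, the natural map between them — Def 5.5 (iii), Def 4.6 (iii),
  Cor 5.6 (ii)), with a consistency inhabitant over the toy kits;
* `ThetaPMEllNFHT.Iso`: a pair (isomorphism of the Θ^{±ell}-Hodge theaters at the `ℱ`-level —
  `ThetaPMEllHT.IsoF` of `ThetaPMEllHodgeTheatersF.lean` —, isomorphism of the ΘNF-Hodge theaters)
  compatible with the gluing isomorphisms (the index square `J → T^⋇` commutes); `DThetaPMEllNFHT.Iso`
  likewise; the full poly-isomorphisms `fullPolyIso` and the predicate `IsFullPolyIso` for both.

The associated 𝒟-Θ^{±ell}NF-Hodge theater of a Θ^{±ell}NF-Hodge theater is not constructed here: with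
the 𝒟-version's NF-data placed directly on Proposition 6.7's output (`DThetaPMEllNFHT`), transporting
the ΘNF side's 𝒟-NF-bridge along the (full) gluing poly-isomorphism would need an isomorphism-invariance
law for `IsDThetaNFHT` that `S5Local` does not state (recorded; TODO-merge:abc-iut-L5-t3).
-/

namespace Literature.IUT.HodgeTheaters

open CategoryTheory

universe u

namespace PMBaseKit

variable {l : ℕ} {K : PMBaseKit.{u} l} {M : K.MultKit} {FK : K.FKit M} (N : K.S5Local M FK)

namespace S5Local

/-- A **𝒟-ΘNF-Hodge theater in kit form** ([IUTchI] Def 4.6 (iii) p. 112: `†ℋ𝒯^{𝒟-ΘNF} = (†𝒟^⊚ ⟵ †𝔇_J ⟶ †𝔇_>)`,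
"a 𝒟-NF-bridge and a 𝒟-Θ-bridge … such that …"): a 𝒟-Θ-bridge datum, a global object `†𝒟^⊚`, the
𝒟-NF-bridge poly-morphisms on the same capsule, satisfying the kit predicate `IsDThetaNFHT`
(TODO-merge:abc-iut-L5-t3 `DThetaNFHodgeTheater`). ([IUTchI] Def 4.6 (iii) p.112) [claim: Mochizuki2012, status: disputed] -/
structure DNFHT where
  /-- the 𝒟-Θ-bridge `†φ^Θ_⋇ : †𝔇_J → †𝔇_>` -/
  thBridge : K.DThetaBridgeData
  /-- the global object `†𝒟^⊚` -/
  glob : N.CatAmb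
  /-- the 𝒟-NF-bridge poly-morphisms `†φ^{NF}_j : †𝒟_{v_j} → †𝒟^⊚` -/
  nfPoly : ∀ j v, Set ((thBridge.capsule j).obj v ⟶ (N.nfAtV v).obj glob)
  /-- "forms a 𝒟-ΘNF-Hodge theater" -/
  isHT : N.IsDThetaNFHT thBridge glob nfPoly

/-- TODO-merge:abc-iut-L5-t3 Def 5.5 (ii), (iii), Def 4.6 (iii), Cor 5.6 (ii). **Hypothesis kit for the
isomorphism notions on the ΘNF side**, which `S5Local` does not carry: the associated 𝒟-ΘNF-Hodge
theater of a ΘNF-Hodge theater ("the associated data `{‡φ^{NF}_⋇, ‡φ^Θ_⋇}` forms a 𝒟-ΘNF-Hodge theater",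
[IUTchI] Def 5.5 (iii) p. 153), the types of isomorphisms of ΘNF-Hodge theaters (Def 5.5 (iii):
"a pair of morphisms between the respective associated NF- and Θ-bridges that … induce the same
bijection between the index sets") and of 𝒟-ΘNF-Hodge theaters (Def 4.6 (iii) p. 112, same wording),
the bijections of index sets they induce, and "the natural functorially induced map" from the former
to the latter (Cor 5.6 (ii) p. 153). ([IUTchI] Def 5.5 (iii) p.153) [claim: Mochizuki2012, status: disputed] -/
structure IsoKit where
  /-- TODO-merge:abc-iut-L5-t3 Def 5.5 (iii): the global object `‡𝒟^⊚` of the associated 𝒟-ΘNF-Hodge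
  theater of a ΘNF-Hodge theater -/
  thGlob : N.ThetaNFHT → N.CatAmb
  /-- … and its 𝒟-NF-bridge poly-morphisms on the capsule `‡𝔇_J` -/
  thNFPoly : ∀ (H : N.ThetaNFHT) (j : ULift.{u} (N.thJ H)) (v : K.V),
    Set (((N.thetaBridgeData H).capsule j).obj v ⟶ (N.nfAtV v).obj (thGlob H))
  /-- … which form, with the associated 𝒟-Θ-bridge, a 𝒟-ΘNF-Hodge theater -/
  th_isHT : ∀ H, N.IsDThetaNFHT (N.thetaBridgeData H) (thGlob H) (thNFPoly H)
  /-- TODO-merge:abc-iut-L5-t3 `ThetaNFHodgeTheater.Hom`: isomorphisms of ΘNF-Hodge theaters -/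
  thIso : N.ThetaNFHT → N.ThetaNFHT → Type u
  /-- the bijection of index sets `J ⥲ J'` induced by an isomorphism of ΘNF-Hodge theaters -/
  thIsoIndex : ∀ {H₁ H₂ : N.ThetaNFHT}, thIso H₁ H₂ → (N.thJ H₁ ≃ N.thJ H₂)
  /-- TODO-merge:abc-iut-L5-t3 `DThetaNFHodgeTheater.Hom`: isomorphisms of 𝒟-ΘNF-Hodge theaters -/
  dIso : N.DNFHT → N.DNFHT → Type u
  /-- the bijection of index sets induced by an isomorphism of 𝒟-ΘNF-Hodge theaters -/
  dIsoIndex : ∀ {X₁ X₂ : N.DNFHT}, dIso X₁ X₂ → (X₁.thBridge.J ≃ X₂.thBridge.J)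
  /-- Cor 5.6 (ii): "the natural functorially induced map" from isomorphisms of ΘNF-Hodge theaters to
  isomorphisms of the associated 𝒟-ΘNF-Hodge theaters … -/
  thIsoToD : ∀ {H₁ H₂ : N.ThetaNFHT}, thIso H₁ H₂ →
    dIso ⟨N.thetaBridgeData H₁, thGlob H₁, thNFPoly H₁, th_isHT H₁⟩
      ⟨N.thetaBridgeData H₂, thGlob H₂, thNFPoly H₂, th_isHT H₂⟩
  /-- … which induces the same bijection of index sets -/
  thIsoToD_index : ∀ {H₁ H₂ : N.ThetaNFHT} (f : thIso H₁ H₂) (j : N.thJ H₁),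
    dIsoIndex (thIsoToD f) ⟨j⟩ = ⟨thIsoIndex f j⟩

/-- The associated 𝒟-ΘNF-Hodge theater of a ΘNF-Hodge theater ([IUTchI] Def 5.5 (iii) p. 153).
([IUTchI] Def 5.5 (iii) p.153) [claim: Mochizuki2012, status: disputed] -/
noncomputable def IsoKit.assocD {N : K.S5Local M FK} (NI : N.IsoKit) (H : N.ThetaNFHT) : N.DNFHT :=
  ⟨N.thetaBridgeData H, NI.thGlob H, NI.thNFPoly H, NI.th_isHT H⟩

variable {N}

/-- The 𝒟-ΘNF-Hodge theater (b) of a 𝒟-Θ^{±ell}NF-Hodge theater, packaged in kit form (its 𝒟-Θ-bridge is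
Proposition 6.7's output, [IUTchI] Def 6.13 (ii) p. 183 in the rendering of `DThetaPMEllNFHT`).
([IUTchI] Def 6.13 (ii) p.183) [claim: Mochizuki2012, status: disputed] -/
noncomputable def DThetaPMEllNFHT.dnf {hl : Odd l} (X : N.DThetaPMEllNFHT hl) : N.DNFHT :=
  ⟨X.pmEll.pmBridge.thetaBridgeData M hl, X.glob, X.nfPoly, X.isHT⟩

/-- **Rmk 6.12.2 (ii)**, isomorphisms of Θ^{±ell}NF-Hodge theaters ("by applying Propositions 4.8, 6.6,
and Corollaries 5.6, 6.12, one may verify analogues of these results for such Θ^{±ell}NF-Hodge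
theaters", [IUTchI] Rmk 6.12.2 (ii) pp. 174–175; the notion [IUTchII] §4 and [IUTchIII] Def 1.1, 3.8
use): by analogy with Def 5.5 (iii) / Def 6.11 (iii), a pair consisting of an isomorphism of the
Θ^{±ell}-Hodge theaters (a) — at the `ℱ`-level, `ThetaPMEllHT.IsoF` — and an isomorphism of the
ΘNF-Hodge theaters (b), compatible with the gluing isomorphisms (c): through `T ⥲ T' ↦ T^⋇ ⥲ T'^⋇` and
`J ⥲ J'` the square of index sets commutes. ([IUTchI] Rmk 6.12.2 (ii) p.174) [claim: Mochizuki2012, status: disputed] -/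
structure ThetaPMEllNFHT.Iso (NI : N.IsoKit) {hl : Odd l} (X₁ X₂ : N.ThetaPMEllNFHT hl) where
  /-- the isomorphism of Θ^{±ell}-Hodge theaters (`ℱ`-level) -/
  pm : FKit.ThetaPMEllHT.IsoF X₁.pmEll X₂.pmEll
  /-- the isomorphism of ΘNF-Hodge theaters -/
  nf : NI.thIso X₁.thNF X₂.thNF
  /-- compatibility with the gluing isomorphisms: the square `J → T^⋇`, `J' → T'^⋇` commutes -/
  compat : ∀ (j : N.thJ X₁.thNF) (t : X₁.pmEll.T),
    X₁.pmEll.grpT.toAbs t = (X₁.gluing.indexEquiv j).1 →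
      X₂.pmEll.grpT.toAbs (pm.toD.pmIso.indexEquiv t) = (X₂.gluing.indexEquiv (NI.thIsoIndex nf j)).1

/-- **Rmk 6.12.2 (ii)**, isomorphisms of 𝒟-Θ^{±ell}NF-Hodge theaters (analogue of Def 4.6 (iii) / Def 6.4
(iii)): an isomorphism of the 𝒟-Θ^{±ell}-Hodge theaters and an isomorphism of the 𝒟-ΘNF-Hodge theaters
inducing compatible bijections of index sets (here the 𝒟-ΘNF-Hodge theater's index set IS `T^⋇`, the
gluing of `DThetaPMEllNFHT` being the identity). ([IUTchI] Rmk 6.12.2 (ii) p.175) [claim: Mochizuki2012, status: disputed] -/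
structure DThetaPMEllNFHT.Iso (NI : N.IsoKit) {hl : Odd l} (X₁ X₂ : N.DThetaPMEllNFHT hl) where
  /-- the isomorphism of 𝒟-Θ^{±ell}-Hodge theaters -/
  pm : DThetaPMEllHT.Iso X₁.pmEll X₂.pmEll
  /-- the isomorphism of 𝒟-ΘNF-Hodge theaters -/
  nf : NI.dIso X₁.dnf X₂.dnf
  /-- compatibility: the bijection `T^⋇ ⥲ T'^⋇` induced by `nf` is the one induced by `pm` -/
  compat : ∀ (q : ULift X₁.pmEll.pmBridge.grpT.AbsStar) (t : X₁.pmEll.T),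
    X₁.pmEll.grpT.toAbs t = q.down.1 →
      X₂.pmEll.grpT.toAbs (pm.pmIso.indexEquiv t) = (NI.dIsoIndex nf q).down.1

/-- The **full poly-isomorphism** between two Θ^{±ell}NF-Hodge theaters: the set of all isomorphisms
(§0 p. 33 "full poly-isomorphism"; the noun of [IUTchII] Cor 4.10 (iii), [IUTchIII] Def 1.1 (iii),
Def 3.8). ([IUTchI] Rmk 6.12.2 (ii) p.175) [claim: Mochizuki2012, status: disputed] -/
def ThetaPMEllNFHT.fullPolyIso (NI : N.IsoKit) {hl : Odd l} (X₁ X₂ : N.ThetaPMEllNFHT hl) :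
    Set (ThetaPMEllNFHT.Iso NI X₁ X₂) := Set.univ

/-- A poly-isomorphism of Θ^{±ell}NF-Hodge theaters **is full** if it is the full poly-isomorphism (all
isomorphisms; §0 p. 33). ([IUTchI] Rmk 6.12.2 (ii) p.175) [claim: Mochizuki2012, status: disputed] -/
def ThetaPMEllNFHT.IsFullPolyIso {NI : N.IsoKit} {hl : Odd l} {X₁ X₂ : N.ThetaPMEllNFHT hl}
    (P : Set (ThetaPMEllNFHT.Iso NI X₁ X₂)) : Prop := P = Set.univ

/-- The **full poly-isomorphism** between two 𝒟-Θ^{±ell}NF-Hodge theaters: all isomorphisms (§0 p. 33;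
the noun of [IUTchII] Cor 4.10, [IUTchIII] Def 1.1 for the 𝒟-versions).
([IUTchI] Rmk 6.12.2 (ii) p.175) [claim: Mochizuki2012, status: disputed] -/
def DThetaPMEllNFHT.fullPolyIso (NI : N.IsoKit) {hl : Odd l} (X₁ X₂ : N.DThetaPMEllNFHT hl) :
    Set (DThetaPMEllNFHT.Iso NI X₁ X₂) := Set.univ

/-- A poly-isomorphism of 𝒟-Θ^{±ell}NF-Hodge theaters **is full** if it is the full poly-isomorphism.
([IUTchI] Rmk 6.12.2 (ii) p.175) [claim: Mochizuki2012, status: disputed] -/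
def DThetaPMEllNFHT.IsFullPolyIso {NI : N.IsoKit} {hl : Odd l} {X₁ X₂ : N.DThetaPMEllNFHT hl}
    (P : Set (DThetaPMEllNFHT.Iso NI X₁ X₂)) : Prop := P = Set.univ

/-- **Rmk 6.12.2 (ii) / Def 6.13 (i) (c)**, guarded form of abc-iut-L5-t4's `GluingUnique`: "by
Proposition 4.8, (ii); Corollary 5.6, (ii), the gluing isomorphism that occurs in such a gluing
operation is unique" ([IUTchI] Rmk 6.12.2 (ii) p. 174) under the standing hypothesis `𝕍^bad ≠ ∅` of
Def 3.1 (b) — the labels `∈ 𝔽_l^⋇` that force uniqueness live at `v ∈ 𝕍^bad` (Prop 4.7 (i), 4.8 (ii));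
with `𝕍^bad = ∅` Proposition 6.7's poly-morphisms are all full and the unguarded statement fails in
kit instances with `|T^⋇| ≥ 2` — named statement, NOT asserted.
([IUTchI] Rmk 6.12.2 (ii) p.174) [claim: Mochizuki2012, status: disputed] -/
def GluingUniqueBad (hl : Odd l) : Prop := K.bad.Nonempty → N.GluingUnique hl

end S5Local

/-! ### Consistency: an inhabitant of the isomorphism kit over the toy kits -/

/-- A model of `S5Local.IsoKit` over `S5Local.toy` (prime `l ≠ 2`): the one global object, empty NF
data, isomorphism types `PUnit` on the ΘNF side and "bijections of index sets" on the 𝒟 side —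
witnessing that the kit has honest inhabitants ([IUTchI] Def 5.5 (iii) p. 153).
([IUTchI] Def 5.5 (iii) p.153) [claim: Mochizuki2012, status: disputed] -/
noncomputable def S5Local.IsoKit.toy (l : ℕ) [Fact l.Prime] (hl : l ≠ 2) : (S5Local.toy l hl).IsoKit where
  thGlob _ := SingleObj.star (Model.AGL l)
  thNFPoly _ j _ := j.down.elim
  th_isHT _ := trivial
  thIso _ _ := PUnit
  thIsoIndex _ := Equiv.refl _
  dIso X₁ X₂ := X₁.thBridge.J ≃ X₂.thBridge.J
  dIsoIndex e := e
  thIsoToD _ := Equiv.refl _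
  thIsoToD_index _ j := j.elim

end PMBaseKit

end Literature.IUT.HodgeTheaters
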